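import Summits.ABC.ABC.Theorems.RibetTakahashiSplitManyPrimeValuationProductOmegaLogLog
import Literature.NumberTheory.DiophantineGeometry.ConductorRadicalProofs

/-!
# Calibration of the crux `ManyPrimeValuationProduct`: quasi-polynomial Szpiro suffices

Support file for crux stmt-ABC-1561 (route `RibetTakahashiSplit`); `T(E) := ∏_{p ∥ N} ord_p(Δ_min)`.
THE CALIBRATION (crux disprover, `Disproof.lean` v4 §5, re-derived so that it is importable):
`(∀ η > 0, ∃ C, ∀ E in the class, log |Δ_min(E)| ≤ C (1 + log N_E)^{1+η}) ⟹ r2 ∧ r4`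
(`manyPrime_and_fewPrime_of_quasiPolySzpiro`; engine `valuationProduct_le_of_quasiPolySzpiro` for
any class `P`).  Proof (entropy count, constants explicit): with `L = log N`, `x = 1 + L`,
`B = C x^{1+η}/log 2 ≥ Σ_{p ∥ N} v_p` and threshold `V = x^{2η}`,
`log T = Σ log v_p ≤ ω(N) log V + (B/V) log B`, where `ω(N) log V = 2η ω(N) log(1+L) ≤ 2η (C₀+1) L`
by the landed `stub_omegaLogLog` and `2^{ω(N)} ≤ N`, and `(B/V) log B ≪ x^{1−η/2} ≤ δ x + δ^{−2/η}`;
`η = ε/(4(C₀+1))` and `δ` small give `log T ≤ ε L + K_ε`.  So the crux needs only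
`|Δ_min| ≤ exp((log N)^{1+o(1)})` on the class, weaker than any polynomial Szpiro bound.
Companion: `…ManyPrimeValuationProductBootstrap.lean` (poly-Szpiro / r3′ / Szpiro / ABC ⟹ r2 ∧ r4).
No new definitions.
-/

-- `Summit.<Summit>.<Problem>` is the mandated summit-side namespace (CONVENTIONS §2); for the
-- single-conjunct summit `ABC` the two coincide, so the duplicate `ABC.ABC` is deliberate.
set_option linter.dupNamespace false

namespace Summit.ABC.ABC.Theorems

open scoped Classical
open Finset
open Summit.ABC.ABC.Theses.RibetTakahashiSplit

namespace ManyPrimeValuationProduct.QuasiPoly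

/-! ### Elementary real inequalities -/

/-- `log x ≤ xᵃ / a` for `a > 0`, `x > 0` (`log y ≤ y − 1` at `y = xᵃ`). [folklore] -/
theorem log_le_rpow_div {a x : ℝ} (ha : 0 < a) (hx : 0 < x) : Real.log x ≤ x ^ a / a := by
  have h1 : Real.log (x ^ a) ≤ x ^ a - 1 := Real.log_le_sub_one_of_pos (Real.rpow_pos_of_pos hx a)
  rw [Real.log_rpow hx] at h1
  rw [le_div_iff₀ ha]
  linarith

/-- `x^{1−θ} ≤ δ x + δ^{−1/θ}` for `x ≥ 1`, `θ > 0`, `δ > 0`: if `x^θ ≥ δ⁻¹` then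
`x^{1−θ} = x/x^θ ≤ δ x`, otherwise `x < δ^{−1/θ}` and `x^{1−θ} ≤ x`. [folklore] -/
theorem rpow_one_sub_le {x θ δ : ℝ} (hx : 1 ≤ x) (hθ : 0 < θ) (hδ : 0 < δ) :
    x ^ (1 - θ) ≤ δ * x + δ ^ (-(1 / θ)) := by
  have hx0 : 0 < x := lt_of_lt_of_le one_pos hx
  have hxθ : 0 < x ^ θ := Real.rpow_pos_of_pos hx0 θ
  have hsplit : x ^ (1 - θ) = x / x ^ θ := by
    rw [Real.rpow_sub hx0, Real.rpow_one]
  have hpow0 : 0 ≤ δ ^ (-(1 / θ)) := Real.rpow_nonneg hδ.le _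
  by_cases hcase : δ⁻¹ ≤ x ^ θ
  · -- large `x`
    have h1 : x / x ^ θ ≤ δ * x := by
      rw [div_le_iff₀ hxθ]
      have : x * δ⁻¹ ≤ x * x ^ θ := mul_le_mul_of_nonneg_left hcase hx0.le
      calc x = δ * (x * δ⁻¹) := by field_simp
        _ ≤ δ * (x * x ^ θ) := mul_le_mul_of_nonneg_left this hδ.le
        _ = δ * x * x ^ θ := by ring
    rw [hsplit]
    linarith [mul_nonneg hδ.le hx0.le]
  · -- small `x`: `x^θ < δ⁻¹`, so `x < δ^{-1/θ}`
    push Not at hcase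
    have h1 : x ^ (1 - θ) ≤ x := by
      calc x ^ (1 - θ) ≤ x ^ (1 : ℝ) := Real.rpow_le_rpow_of_exponent_le hx (by linarith)
        _ = x := Real.rpow_one x
    have h2 : x ≤ δ ^ (-(1 / θ)) := by
      have h3 : (x ^ θ) ^ (1 / θ) ≤ (δ⁻¹) ^ (1 / θ) :=
        Real.rpow_le_rpow hxθ.le hcase.le (by positivity)
      rw [← Real.rpow_mul hx0.le, mul_one_div_cancel hθ.ne', Real.rpow_one] at h3
      rwa [Real.rpow_neg hδ.le, ← Real.inv_rpow hδ.le]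
    linarith [mul_nonneg hδ.le hx0.le]

/-! ### Arithmetic inputs -/

/-- Every factor of `T(E)` is `≥ 1` (the conductor and the minimal discriminant have the same prime
factors, `radical_conductorNorm_eq_holds`). [folklore] -/
theorem one_le_factorization (W : WeierstrassCurve ℚ) [W.IsElliptic] {p : ℕ}
    (hp : p ∈ (W.conductorNorm ℤ).primeFactors) :
    1 ≤ (W.minimalDiscriminantNorm ℤ).factorization p := by
  have hrad : UniqueFactorizationMonoid.radical (W.conductorNorm ℤ) =
      UniqueFactorizationMonoid.radical (W.minimalDiscriminantNorm ℤ) :=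
    W.radical_conductorNorm_eq_holds
  have hpf : (W.conductorNorm ℤ).primeFactors = (W.minimalDiscriminantNorm ℤ).primeFactors := by
    rw [← Nat.primeFactors_radical, hrad, Nat.primeFactors_radical]
  rw [hpf] at hp
  obtain ⟨hpp, hpd, hne⟩ := Nat.mem_primeFactors.mp hp
  exact hpp.factorization_pos_of_dvd hne hpd

/-- `Σ_{p ∈ S} v_p(n) · log 2 ≤ log n` for `n ≠ 0` and `S` a set of prime factors of `n`
(`2^{Σ v_p} ≤ ∏ p^{v_p} ≤ n`). [folklore] -/
theorem sum_factorization_mul_log_two_le {n : ℕ} (hn : n ≠ 0) {S : Finset ℕ}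
    (hS : S ⊆ n.primeFactors) :
    ((∑ p ∈ S, n.factorization p : ℕ) : ℝ) * Real.log 2 ≤ Real.log n := by
  have hfull : ∏ p ∈ n.primeFactors, p ^ n.factorization p = n := by
    conv_rhs => rw [← Nat.prod_factorization_pow_eq_self hn]
    rw [Finsupp.prod, Nat.support_factorization]
  have hdvd : ∏ p ∈ S, p ^ n.factorization p ∣ n := by
    conv_rhs => rw [← hfull]
    exact Finset.prod_dvd_prod_of_subset _ _ _ hS
  have hle : 2 ^ (∑ p ∈ S, n.factorization p) ≤ n := by
    calc 2 ^ (∑ p ∈ S, n.factorization p) = ∏ p ∈ S, 2 ^ n.factorization p :=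
          (Finset.prod_pow_eq_pow_sum S (n.factorization ·) 2).symm
      _ ≤ ∏ p ∈ S, p ^ n.factorization p :=
          Finset.prod_le_prod' (fun p hp =>
            Nat.pow_le_pow_left (Nat.prime_of_mem_primeFactors (hS hp)).two_le _)
      _ ≤ n := Nat.le_of_dvd (Nat.pos_of_ne_zero hn) hdvd
  have hle' : ((2 : ℝ)) ^ (∑ p ∈ S, n.factorization p) ≤ (n : ℝ) := by exact_mod_cast hle
  have := Real.log_le_log (by positivity) hle'
  rwa [Real.log_pow] at this

/-- `ω(n) · log 2 ≤ log n` for `n ≠ 0` (`2^{ω(n)} ≤ ∏_{p ∣ n} p ≤ n`). [folklore] -/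
theorem card_primeFactors_mul_log_two_le {n : ℕ} (hn : n ≠ 0) :
    (n.primeFactors.card : ℝ) * Real.log 2 ≤ Real.log n := by
  have hle : 2 ^ n.primeFactors.card ≤ n := by
    calc 2 ^ n.primeFactors.card = ∏ p ∈ n.primeFactors, 2 := by
          rw [Finset.prod_const]
      _ ≤ ∏ p ∈ n.primeFactors, p :=
          Finset.prod_le_prod' (fun p hp => (Nat.prime_of_mem_primeFactors hp).two_le)
      _ ≤ n := Nat.le_of_dvd (Nat.pos_of_ne_zero hn) (Nat.prod_primeFactors_dvd n)
  have hle' : ((2 : ℝ)) ^ n.primeFactors.card ≤ (n : ℝ) := by exact_mod_cast hle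
  have := Real.log_le_log (by positivity) hle'
  rwa [Real.log_pow] at this

/-- From the landed maximal-order bound `ω(n) log log n ≤ C₀ log n` (`stub_omegaLogLog`) and
`ω(n) log 2 ≤ log n`: `ω(n) · log(1 + log n) ≤ (C₀ + 1) log n` for every `n ≠ 0` and `C₀ ≥ 0`
(split at `log n ≥ 1`, where `log(1+L) ≤ log 2 + log L`). [folklore] -/
theorem card_mul_log_one_add_log_le {C₀ : ℝ} (hC₀ : 0 ≤ C₀)
    (hω : ∀ n : ℕ, (n.primeFactors.card : ℝ) * Real.log (Real.log n) ≤ C₀ * Real.log n)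
    {n : ℕ} (hn : n ≠ 0) :
    (n.primeFactors.card : ℝ) * Real.log (1 + Real.log n) ≤ (C₀ + 1) * Real.log n := by
  set L := Real.log (n : ℝ) with hL
  have hL0 : 0 ≤ L := Real.log_natCast_nonneg n
  have hω0 : (0 : ℝ) ≤ n.primeFactors.card := Nat.cast_nonneg _
  have h2 := card_primeFactors_mul_log_two_le hn
  by_cases h1 : 1 ≤ L
  · have hlog : Real.log (1 + L) ≤ Real.log 2 + Real.log L := by
      rw [← Real.log_mul (by norm_num) (by linarith)]
      exact Real.log_le_log (by linarith) (by linarith)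
    calc (n.primeFactors.card : ℝ) * Real.log (1 + L)
        ≤ (n.primeFactors.card : ℝ) * (Real.log 2 + Real.log L) :=
          mul_le_mul_of_nonneg_left hlog hω0
      _ = (n.primeFactors.card : ℝ) * Real.log 2 +
            (n.primeFactors.card : ℝ) * Real.log L := by ring
      _ ≤ L + C₀ * L := add_le_add h2 (hω n)
      _ = (C₀ + 1) * L := by ring
  · push Not at h1
    have hlog : Real.log (1 + L) ≤ Real.log 2 := Real.log_le_log (by linarith) (by linarith)
    calc (n.primeFactors.card : ℝ) * Real.log (1 + L)
        ≤ (n.primeFactors.card : ℝ) * Real.log 2 := mul_le_mul_of_nonneg_left hlog hω0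
      _ ≤ L := h2
      _ ≤ (C₀ + 1) * L := by nlinarith

/-! ### The entropy count -/

/-- **Entropy count with a threshold.** For naturals `v_p ≥ 1` on a finite set `S` with
`Σ v_p ≤ B`, `B ≥ 1`, and a threshold `V ≥ 1`:
`Σ_{p ∈ S} log v_p ≤ #S · log V + (B/V) · log B` (the `v_p ≤ V` contribute `≤ log V` each; the
`v_p > V` number `≤ B/V` and contribute `≤ log B` each). [folklore] -/
theorem sum_log_le_card_mul_add (S : Finset ℕ) (v : ℕ → ℕ) {B V : ℝ} (hV : 1 ≤ V) (hB : 1 ≤ B)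
    (hv : ∀ p ∈ S, 1 ≤ v p) (hsum : ((∑ p ∈ S, v p : ℕ) : ℝ) ≤ B) :
    ∑ p ∈ S, Real.log (v p) ≤ S.card * Real.log V + B / V * Real.log B := by
  have hlogV : 0 ≤ Real.log V := Real.log_nonneg hV
  have hlogB : 0 ≤ Real.log B := Real.log_nonneg hB
  have hV0 : 0 < V := lt_of_lt_of_le one_pos hV
  rw [← Finset.sum_filter_add_sum_filter_not S (fun p => (v p : ℝ) ≤ V)]
  have h1 : ∑ p ∈ S.filter (fun p => (v p : ℝ) ≤ V), Real.log (v p) ≤ S.card * Real.log V := by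
    have hle := Finset.sum_le_card_nsmul (S.filter (fun p => (v p : ℝ) ≤ V))
      (fun p => Real.log (v p)) (Real.log V) (fun p hp => by
        have hp' := Finset.mem_filter.mp hp
        have hvp : (0 : ℝ) < v p := by exact_mod_cast hv p hp'.1
        exact Real.log_le_log hvp hp'.2)
    rw [nsmul_eq_mul] at hle
    refine hle.trans (mul_le_mul_of_nonneg_right ?_ hlogV)
    exact_mod_cast Finset.card_filter_le _ _
  set S₂ := S.filter (fun p => ¬ (v p : ℝ) ≤ V) with hS₂
  have hsum₂ : ((∑ p ∈ S₂, v p : ℕ) : ℝ) ≤ B := by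
    refine le_trans ?_ hsum
    exact_mod_cast Finset.sum_le_sum_of_subset (Finset.filter_subset _ S)
  have hcard : (S₂.card : ℝ) * V ≤ B := by
    have hle := Finset.card_nsmul_le_sum S₂ (fun p => (v p : ℝ)) V
      (fun p hp => (not_le.mp (Finset.mem_filter.mp hp).2).le)
    rw [nsmul_eq_mul] at hle
    refine hle.trans ?_
    rw [← Nat.cast_sum]
    exact hsum₂
  have hcard' : (S₂.card : ℝ) ≤ B / V := by
    rw [le_div_iff₀ hV0]; exact hcard
  have h2 : ∑ p ∈ S₂, Real.log (v p) ≤ B / V * Real.log B := by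
    have hle := Finset.sum_le_card_nsmul S₂ (fun p => Real.log (v p)) (Real.log B)
      (fun p hp => by
        have hpS : p ∈ S := (Finset.mem_filter.mp hp).1
        have hvp : (0 : ℝ) < v p := by exact_mod_cast hv p hpS
        have hvB : (v p : ℝ) ≤ B := by
          refine le_trans ?_ hsum
          exact_mod_cast Finset.single_le_sum (fun q _ => Nat.zero_le (v q)) hpS
        exact Real.log_le_log hvp hvB)
    rw [nsmul_eq_mul] at hle
    exact hle.trans (mul_le_mul_of_nonneg_right hcard' hlogB)
  exact add_le_add h1 h2

/-! ### The two terms of the count -/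

/-- First term: with the threshold `V = (1 + log n)^{2η}`, `η = ε/(4(C₀+1))`, and `m ≤ ω(n)`:
`m · log V ≤ (ε/2) log n` (from `card_mul_log_one_add_log_le`). [folklore] -/
theorem card_mul_log_threshold_le {C₀ ε : ℝ} (hC₀ : 0 ≤ C₀) (hε : 0 < ε)
    (hω : ∀ n : ℕ, (n.primeFactors.card : ℝ) * Real.log (Real.log n) ≤ C₀ * Real.log n)
    {n : ℕ} (hn : n ≠ 0) {m : ℕ} (hm : m ≤ n.primeFactors.card) :
    (m : ℝ) * Real.log ((1 + Real.log n) ^ (2 * (ε / (4 * (C₀ + 1))))) ≤ ε / 2 * Real.log n := by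
  have hL0 : 0 ≤ Real.log (n : ℝ) := Real.log_natCast_nonneg n
  have hx0 : 0 < 1 + Real.log (n : ℝ) := by linarith
  have hlog1 : 0 ≤ Real.log (1 + Real.log (n : ℝ)) := Real.log_nonneg (by linarith)
  have h1 := card_mul_log_one_add_log_le hC₀ hω hn
  have hm' : (m : ℝ) ≤ n.primeFactors.card := by exact_mod_cast hm
  have hC₀1 : 0 < C₀ + 1 := by linarith
  rw [Real.log_rpow hx0]
  have hη0 : 0 ≤ 2 * (ε / (4 * (C₀ + 1))) := by positivity
  calc (m : ℝ) * (2 * (ε / (4 * (C₀ + 1))) * Real.log (1 + Real.log n))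
      = 2 * (ε / (4 * (C₀ + 1))) * ((m : ℝ) * Real.log (1 + Real.log n)) := by ring
    _ ≤ 2 * (ε / (4 * (C₀ + 1))) * ((n.primeFactors.card : ℝ) * Real.log (1 + Real.log n)) :=
        mul_le_mul_of_nonneg_left (mul_le_mul_of_nonneg_right hm' hlog1) hη0
    _ ≤ 2 * (ε / (4 * (C₀ + 1))) * ((C₀ + 1) * Real.log n) :=
        mul_le_mul_of_nonneg_left h1 hη0
    _ = ε / 2 * Real.log n := by
        field_simp
        ring

/-- Second term: with `B = c₁ x^{1+η}`, `V = x^{2η}` (`c₁ ≥ 1`, `η > 0`, `x ≥ 1`):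
`(B/V) log B ≤ c₁ (log c₁ + 2(1+η)/η) · x^{1−η/2}` (`log x ≤ (2/η) x^{η/2}` and
`x^{1−η} ≤ x^{1−η/2}`). [folklore] -/
theorem bDivV_mul_log_le {c₁ η x : ℝ} (hc₁ : 1 ≤ c₁) (hη : 0 < η) (hx : 1 ≤ x) :
    c₁ * x ^ (1 + η) / x ^ (2 * η) * Real.log (c₁ * x ^ (1 + η)) ≤
      c₁ * (Real.log c₁ + 2 * (1 + η) / η) * x ^ (1 - η / 2) := by
  have hx0 : 0 < x := by linarith
  have hc₁0 : 0 < c₁ := by linarith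
  have hBV : c₁ * x ^ (1 + η) / x ^ (2 * η) = c₁ * x ^ (1 - η) := by
    rw [mul_div_assoc, ← Real.rpow_sub hx0]
    congr 1
    ring_nf
  have hlogc₁ : 0 ≤ Real.log c₁ := Real.log_nonneg hc₁
  have hlogx : Real.log x ≤ x ^ (η / 2) / (η / 2) := log_le_rpow_div (by positivity) hx0
  have hlogB : Real.log (c₁ * x ^ (1 + η)) ≤
      Real.log c₁ + (1 + η) * (x ^ (η / 2) / (η / 2)) := by
    rw [Real.log_mul hc₁0.ne' (Real.rpow_pos_of_pos hx0 _).ne', Real.log_rpow hx0]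
    have h1η : 0 ≤ 1 + η := by linarith
    linarith [mul_le_mul_of_nonneg_left hlogx h1η]
  have hx1η : x ^ (1 - η) ≤ x ^ (1 - η / 2) :=
    Real.rpow_le_rpow_of_exponent_le hx (by linarith)
  have hxmul : x ^ (1 - η) * x ^ (η / 2) = x ^ (1 - η / 2) := by
    rw [← Real.rpow_add hx0]
    congr 1
    ring
  have hxpos : 0 ≤ x ^ (1 - η) := Real.rpow_nonneg hx0.le _
  rw [hBV]
  calc c₁ * x ^ (1 - η) * Real.log (c₁ * x ^ (1 + η))
      ≤ c₁ * x ^ (1 - η) * (Real.log c₁ + (1 + η) * (x ^ (η / 2) / (η / 2))) :=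
        mul_le_mul_of_nonneg_left hlogB (by positivity)
    _ = c₁ * Real.log c₁ * x ^ (1 - η) +
          c₁ * (2 * (1 + η) / η) * (x ^ (1 - η) * x ^ (η / 2)) := by
        field_simp
    _ ≤ c₁ * Real.log c₁ * x ^ (1 - η / 2) + c₁ * (2 * (1 + η) / η) * x ^ (1 - η / 2) := by
        rw [hxmul]
        have h := mul_le_mul_of_nonneg_left hx1η (mul_nonneg hc₁0.le hlogc₁)
        linarith
    _ = c₁ * (Real.log c₁ + 2 * (1 + η) / η) * x ^ (1 - η / 2) := by ring

/-- **Quasi-polynomial Szpiro on a class gives `T ≤ C_ε N^ε` on that class.** If for every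
`η > 0` there is `C` with `log |Δ_min(E)| ≤ C (1 + log N_E)^{1+η}` for all elliptic `E/ℚ` in `P`,
then for every `ε > 0` there is `C'` with `T(E) ≤ C' N_E^ε` on `P`.  Constants: `C₀` from
`stub_omegaLogLog`, `η = ε/(4(C₀+1))`, `c = max(C_η,1)`, `c₁ = c/log 2`,
`c₂ = c₁ (log c₁ + 2(1+η)/η)`, `δ = ε/(2(c₂+1))`, `C' = exp(c₂ δ + c₂ δ^{−2/η})`. [folklore] -/
theorem valuationProduct_le_of_quasiPolySzpiro {P : WeierstrassCurve ℚ → Prop}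
    (h : ∀ η : ℝ, 0 < η → ∃ C : ℝ, ∀ (W : WeierstrassCurve ℚ) [W.IsElliptic], P W →
      Real.log (W.minimalDiscriminantNorm ℤ) ≤ C * (1 + Real.log (W.conductorNorm ℤ)) ^ (1 + η)) :
    ∀ ε : ℝ, 0 < ε → ∃ C' : ℝ, ∀ (W : WeierstrassCurve ℚ) [W.IsElliptic], P W →
      ((∏ p ∈ (W.conductorNorm ℤ).primeFactors with ¬ p ^ 2 ∣ W.conductorNorm ℤ,
          (W.minimalDiscriminantNorm ℤ).factorization p : ℕ) : ℝ)
        ≤ C' * ((W.conductorNorm ℤ : ℕ) : ℝ) ^ ε := by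
  intro ε hε
  obtain ⟨C₀', hC₀'⟩ := _root_.Summit.ABC.ABC.Theorems.stub_omegaLogLog
  obtain ⟨C₀, hC₀def⟩ : ∃ C₀ : ℝ, C₀ = max C₀' 0 := ⟨_, rfl⟩
  have hC₀ : 0 ≤ C₀ := hC₀def ▸ le_max_right _ _
  have hω : ∀ n : ℕ, (n.primeFactors.card : ℝ) * Real.log (Real.log n) ≤ C₀ * Real.log n :=
    fun n => (hC₀' n).trans
      (mul_le_mul_of_nonneg_right (hC₀def ▸ le_max_left _ _) (Real.log_natCast_nonneg n))
  obtain ⟨η, hηdef⟩ : ∃ η : ℝ, η = ε / (4 * (C₀ + 1)) := ⟨_, rfl⟩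
  have hη : 0 < η := by rw [hηdef]; positivity
  obtain ⟨C, hC⟩ := h η hη
  obtain ⟨c₁, hc₁def⟩ : ∃ c₁ : ℝ, c₁ = max C 1 / Real.log 2 := ⟨_, rfl⟩
  have hlog2 : 0 < Real.log 2 := Real.log_pos (by norm_num)
  have hlog2' : Real.log 2 ≤ 1 := by
    have := Real.log_two_lt_d9
    linarith
  have hc₁1 : 1 ≤ c₁ := by
    rw [hc₁def, le_div_iff₀ hlog2]
    linarith [le_max_right C 1]
  have hc₁0 : 0 < c₁ := lt_of_lt_of_le one_pos hc₁1
  obtain ⟨c₂, hc₂def⟩ : ∃ c₂ : ℝ, c₂ = c₁ * (Real.log c₁ + 2 * (1 + η) / η) := ⟨_, rfl⟩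
  have hc₂0 : 0 ≤ c₂ := by
    rw [hc₂def]
    have := Real.log_nonneg hc₁1
    positivity
  obtain ⟨δ, hδdef⟩ : ∃ δ : ℝ, δ = ε / (2 * (c₂ + 1)) := ⟨_, rfl⟩
  have hδ : 0 < δ := by rw [hδdef]; positivity
  have hc₂δ : c₂ * δ ≤ ε / 2 := by
    have h1 : (c₂ + 1) * δ = ε / 2 := by
      rw [hδdef]
      field_simp
    calc c₂ * δ ≤ (c₂ + 1) * δ := mul_le_mul_of_nonneg_right (by linarith) hδ.le
      _ = ε / 2 := h1
  refine ⟨Real.exp (c₂ * δ + c₂ * δ ^ (-(1 / (η / 2)))), fun W _ hW => ?_⟩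
  have hN0 : W.conductorNorm ℤ ≠ 0 := by
    have h0 : 0 < W.conductorNorm ℤ := W.conductorNorm_pos_holds
    exact h0.ne'
  have hD0 : W.minimalDiscriminantNorm ℤ ≠ 0 := by
    have h0 : 0 < W.minimalDiscriminantNorm ℤ := W.minimalDiscriminantNorm_pos_holds
    exact h0.ne'
  have hSsub : (W.conductorNorm ℤ).primeFactors.filter (fun p => ¬ p ^ 2 ∣ W.conductorNorm ℤ) ⊆
      (W.conductorNorm ℤ).primeFactors := Finset.filter_subset _ _
  have hrad : UniqueFactorizationMonoid.radical (W.conductorNorm ℤ) =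
      UniqueFactorizationMonoid.radical (W.minimalDiscriminantNorm ℤ) :=
    W.radical_conductorNorm_eq_holds
  have hpf : (W.conductorNorm ℤ).primeFactors = (W.minimalDiscriminantNorm ℤ).primeFactors := by
    rw [← Nat.primeFactors_radical, hrad, Nat.primeFactors_radical]
  have hv1 : ∀ p ∈ (W.conductorNorm ℤ).primeFactors.filter (fun p => ¬ p ^ 2 ∣ W.conductorNorm ℤ),
      1 ≤ (W.minimalDiscriminantNorm ℤ).factorization p :=
    fun p hp => one_le_factorization W (hSsub hp)
  have hL0 : 0 ≤ Real.log (W.conductorNorm ℤ : ℝ) := Real.log_natCast_nonneg _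
  have hx1 : 1 ≤ 1 + Real.log (W.conductorNorm ℤ : ℝ) := by linarith
  have hxη : 1 ≤ (1 + Real.log (W.conductorNorm ℤ : ℝ)) ^ (1 + η) :=
    Real.one_le_rpow hx1 (by linarith)
  have hB1 : 1 ≤ c₁ * (1 + Real.log (W.conductorNorm ℤ : ℝ)) ^ (1 + η) := by
    nlinarith
  have hsumB : ((∑ p ∈ (W.conductorNorm ℤ).primeFactors.filter
      (fun p => ¬ p ^ 2 ∣ W.conductorNorm ℤ), (W.minimalDiscriminantNorm ℤ).factorization p : ℕ) : ℝ)
        ≤ c₁ * (1 + Real.log (W.conductorNorm ℤ : ℝ)) ^ (1 + η) := by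
    have hSsubD : (W.conductorNorm ℤ).primeFactors.filter (fun p => ¬ p ^ 2 ∣ W.conductorNorm ℤ) ⊆
        (W.minimalDiscriminantNorm ℤ).primeFactors := fun p hp => by
      rw [← hpf]; exact hSsub hp
    have h1 := sum_factorization_mul_log_two_le hD0 hSsubD
    have h2 : Real.log (W.minimalDiscriminantNorm ℤ : ℝ) ≤
        max C 1 * (1 + Real.log (W.conductorNorm ℤ : ℝ)) ^ (1 + η) :=
      (hC W hW).trans (mul_le_mul_of_nonneg_right (le_max_left _ _) (by positivity))
    rw [hc₁def, div_mul_eq_mul_div, le_div_iff₀ hlog2]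
    exact h1.trans h2
  have hV1 : 1 ≤ (1 + Real.log (W.conductorNorm ℤ : ℝ)) ^ (2 * η) :=
    Real.one_le_rpow hx1 (by positivity)
  have hcount := sum_log_le_card_mul_add _ (fun p => (W.minimalDiscriminantNorm ℤ).factorization p)
    hV1 hB1 hv1 hsumB
  have hterm1 := card_mul_log_threshold_le hC₀ hε hω hN0 (Finset.card_le_card hSsub)
  rw [← hηdef] at hterm1
  have hterm2 := bDivV_mul_log_le hc₁1 hη hx1
  rw [← hc₂def] at hterm2
  have hsmall : (1 + Real.log (W.conductorNorm ℤ : ℝ)) ^ (1 - η / 2) ≤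
      δ * (1 + Real.log (W.conductorNorm ℤ : ℝ)) + δ ^ (-(1 / (η / 2))) :=
    rpow_one_sub_le hx1 (by positivity) hδ
  have hpos : ∀ p ∈ (W.conductorNorm ℤ).primeFactors.filter (fun p => ¬ p ^ 2 ∣ W.conductorNorm ℤ),
      (0 : ℝ) < (((W.minimalDiscriminantNorm ℤ).factorization p : ℕ) : ℝ) :=
    fun p hp => by exact_mod_cast hv1 p hp
  have hTpos := Finset.prod_pos hpos
  have hlogT : Real.log (∏ p ∈ (W.conductorNorm ℤ).primeFactors.filter
      (fun p => ¬ p ^ 2 ∣ W.conductorNorm ℤ),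
        (((W.minimalDiscriminantNorm ℤ).factorization p : ℕ) : ℝ)) ≤
      ε * Real.log (W.conductorNorm ℤ : ℝ) + (c₂ * δ + c₂ * δ ^ (-(1 / (η / 2)))) := by
    rw [Real.log_prod (fun p hp => (hpos p hp).ne')]
    have h3 := mul_le_mul_of_nonneg_left hsmall hc₂0
    have h4 := mul_le_mul_of_nonneg_right hc₂δ hL0
    linarith [hcount, hterm1, hterm2, h3, h4]
  have hN1 : (0 : ℝ) < ((W.conductorNorm ℤ : ℕ) : ℝ) := by exact_mod_cast Nat.pos_of_ne_zero hN0
  rw [Nat.cast_prod, ← Real.exp_log hTpos, Real.rpow_def_of_pos hN1, ← Real.exp_add]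
  refine Real.exp_le_exp.mpr ?_
  linarith

end ManyPrimeValuationProduct.QuasiPoly

/-- **Quasi-polynomial Szpiro on the class implies r2 and r4.** If for every `η > 0` there is `C`
with `log |Δ_min(E)| ≤ C (1 + log N_E)^{1+η}` for every elliptic `E/ℚ` semistable away from `2`,
then `ManyPrimeValuationProduct ∧ FewPrimeValuationProduct` (the cardinality hypotheses on the odd
multiplicative primes are not used).  Calibration of the crux: its input strength is
`|Δ_min| ≤ exp((log N)^{1+o(1)})`, NOT Szpiro (crux disprover, Disproof v4 §5). [folklore] -/
theorem manyPrime_and_fewPrime_of_quasiPolySzpiro :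
    (∀ η : ℝ, 0 < η → ∃ C : ℝ, ∀ (W : WeierstrassCurve ℚ) [W.IsElliptic],
      (∀ p : ℕ, p.Prime → p ≠ 2 → ¬ p ^ 2 ∣ W.conductorNorm ℤ) →
      Real.log (W.minimalDiscriminantNorm ℤ) ≤ C * (1 + Real.log (W.conductorNorm ℤ)) ^ (1 + η)) →
    Summit.ABC.ABC.Theses.RibetTakahashiSplit.ManyPrimeValuationProduct ∧
      Summit.ABC.ABC.Theses.RibetTakahashiSplit.FewPrimeValuationProduct := by
  intro h
  have main := ManyPrimeValuationProduct.QuasiPoly.valuationProduct_le_of_quasiPolySzpiro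
    (P := fun W => ∀ p : ℕ, p.Prime → p ≠ 2 → ¬ p ^ 2 ∣ W.conductorNorm ℤ)
    (fun η hη => by
      obtain ⟨C, hC⟩ := h η hη
      exact ⟨C, fun W _ hW => hC W hW⟩)
  unfold ManyPrimeValuationProduct FewPrimeValuationProduct
  refine ⟨fun ε hε => ?_, fun ε hε => ?_⟩
  · obtain ⟨C', hC'⟩ := main ε hε
    exact ⟨C', fun W _ hss _ => hC' W hss⟩
  · obtain ⟨C', hC'⟩ := main ε hε
    exact ⟨C', fun W _ hss _ => hC' W hss⟩

end Summit.ABC.ABC.Theorems
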